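import Summits.FinalStateConjecture.FinalStateConjecture.Theorems.EIHFluxBalanceInertialRecessionStubHigherOrderOmega
import Summits.FinalStateConjecture.FinalStateConjecture.Theorems.EIHFluxBalanceInertialRecessionStubHigherOrderBodyRates

/-!
# Route EIHFluxBalance — `InertialRecession` (E′), line `SketchCleanExcision`, skeleton r13,
# stub `stub_higherOrderSlaving` (EF): the leading variation of the own hole is the coercivity
# variation form, up to quadratic garbage

Helper file for the crux `stmt-FinalStateConjecture-17403`
(`Summit.FinalStateConjecture.FinalStateConjecture.Theses.EIHFluxBalance.InertialRecession`, E′),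
registered stub `stub_higherOrderSlaving` (orders two and three of frozen-vacuum slaving).

For a smooth Lorentz frame path `Λ̃` with inverse `S = Λ̃⁻¹` and (skew) body rate `A = S′Λ̃`, the
body-rate identities `S″ = (A′ + A²)S`, `S‴ = (A″ + 2A′A + AA′ + A³)S` (`…StubHigherOrderBodyRates`)
split the leading term `M • Dω(a, S, z)[(0, S⁽ᵏ⁾, c_k)]` of the `k`-th lab-time variation of a painted
summand (`…StubHigherOrderVariation`, `k = 2, 3`) into the VARIATION FORM of the coercivity statement
`stub_coerSymbolQuant` with frame `Λ̃(t)`, infinitesimal Lorentz part `A⁽ᵏ⁻¹⁾` and translation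
`d = S c_k` (`…StubHigherOrderOmega.higherOrder_smul_fderiv_omega_eq_var`), plus a garbage term that
is quadratic in the body rates (`higherOrder_ownTerm`).

No definitions, no named facts, no `sorry`.
-/

set_option linter.dupNamespace false
set_option maxSynthPendingDepth 6
set_option synthInstance.maxHeartbeats 200000

noncomputable section

namespace Summit.FinalStateConjecture.FinalStateConjecture.Theorems.SublinearIsFree.Slaving

open scoped Topology ContDiff
open Filter Set Function Metric Literature.Geometry.Lorentzian
  Summit.FinalStateConjecture.FinalStateConjecture.Theorems

/-- Norm of a direction `(0, G ∘ S, 0)` and of `M •` a linear image of it. [folklore] -/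
theorem higherOrder_norm_smul_apply_midDir (M : ℝ) (T : (ℝ × (E4 →L[ℝ] E4) × E4) →L[ℝ] (E4 →L[ℝ] E4 →L[ℝ] ℝ))
    (G S : E4 →L[ℝ] E4) :
    ‖M • T ((0 : ℝ), G.comp S, (0 : E4))‖ ≤ |M| * ‖T‖ * ‖G‖ * ‖S‖ := by
  rw [norm_smul, Real.norm_eq_abs, mul_assoc, mul_assoc]
  refine mul_le_mul_of_nonneg_left ?_ (abs_nonneg M)
  calc ‖T ((0 : ℝ), G.comp S, (0 : E4))‖ ≤ ‖T‖ * ‖((0 : ℝ), G.comp S, (0 : E4))‖ := T.le_opNorm _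
    _ ≤ ‖T‖ * (‖G‖ * ‖S‖) := by
        gcongr
        simp only [Prod.norm_def, norm_zero, max_eq_right (norm_nonneg _), max_eq_left (norm_nonneg _)]
        exact ContinuousLinearMap.opNorm_comp_le _ _

set_option maxHeartbeats 1600000 in
/-- **The own-hole leading variations are the coercivity variation forms up to quadratic garbage.**
See the module docstring. [folklore] -/
theorem higherOrder_ownTerm (Λ' : ℝ → lorentzGroup)
    (hΛ's : ContDiff ℝ ∞ (fun t ↦ ((Λ' t : E4 ≃L[ℝ] E4) : E4 →L[ℝ] E4))) (M a t : ℝ) (c₂ c₃ z : E4)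
    (hz : 0 < Kerr.radius a (poincareInv (Λ' t) 0 z)) :
    let F : ℝ → E4 →L[ℝ] E4 := fun s ↦ ((Λ' s : E4 ≃L[ℝ] E4) : E4 →L[ℝ] E4)
    let S : ℝ → E4 →L[ℝ] E4 := fun s ↦ (((Λ' s : E4 ≃L[ℝ] E4).symm : E4 ≃L[ℝ] E4) : E4 →L[ℝ] E4)
    let A : ℝ → E4 →L[ℝ] E4 := fun s ↦ (deriv S s).comp (F s)
    let Dom : (ℝ × (E4 →L[ℝ] E4) × E4) →L[ℝ] (E4 →L[ℝ] E4 →L[ℝ] ℝ) :=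
      fderiv ℝ (fun p : ℝ × (E4 →L[ℝ] E4) × E4 ↦
        (Kerr.bilin 1 p.1 (p.2.1 p.2.2) - Minkowski.bilin).bilinearComp p.2.1 p.2.1) (a, S t, z)
    let G₃ : E4 →L[ℝ] E4 := (2 : ℝ) • (deriv A t).comp (A t) + (A t).comp (deriv A t) +
      ((A t).comp (A t)).comp (A t)
    (M • Dom ((0 : ℝ), iteratedDeriv 2 S t, c₂) =
      ((fderiv ℝ (Kerr.bilin M a) (poincareInv (Λ' t) 0 z) (deriv A t (poincareInv (Λ' t) 0 z) + S t c₂)).bilinearComp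
          (S t) (S t) +
        (Kerr.bilin M a (poincareInv (Λ' t) 0 z)).bilinearComp ((deriv A t).comp (S t)) (S t) +
        (Kerr.bilin M a (poincareInv (Λ' t) 0 z)).bilinearComp (S t) ((deriv A t).comp (S t))) +
      M • Dom ((0 : ℝ), ((A t).comp (A t)).comp (S t), (0 : E4))) ∧
    (M • Dom ((0 : ℝ), iteratedDeriv 3 S t, c₃) =
      ((fderiv ℝ (Kerr.bilin M a) (poincareInv (Λ' t) 0 z) (iteratedDeriv 2 A t (poincareInv (Λ' t) 0 z) + S t c₃)).bilinearComp
          (S t) (S t) +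
        (Kerr.bilin M a (poincareInv (Λ' t) 0 z)).bilinearComp ((iteratedDeriv 2 A t).comp (S t)) (S t) +
        (Kerr.bilin M a (poincareInv (Λ' t) 0 z)).bilinearComp (S t) ((iteratedDeriv 2 A t).comp (S t))) +
      M • Dom ((0 : ℝ), G₃.comp (S t), (0 : E4))) ∧
    ‖M • Dom ((0 : ℝ), ((A t).comp (A t)).comp (S t), (0 : E4))‖ ≤ |M| * ‖Dom‖ * ‖A t‖ ^ 2 * ‖S t‖ ∧
    ‖M • Dom ((0 : ℝ), G₃.comp (S t), (0 : E4))‖ ≤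
      |M| * ‖Dom‖ * (3 * ‖deriv A t‖ * ‖A t‖ + ‖A t‖ ^ 3) * ‖S t‖ := by
  intro F S A Dom G₃
  obtain ⟨-, hS2, hS3, -, hskew', hskew'', -⟩ := higherOrder_bodyRate_identities Λ' hΛ's t
  set L : lorentzGroup := Λ' t with hL
  have hSL : S t = (((L : E4 ≃L[ℝ] E4).symm : E4 ≃L[ℝ] E4) : E4 →L[ℝ] E4) := rfl
  have hLS : ∀ c : E4, (L : E4 ≃L[ℝ] E4) (S t c) = c := fun c ↦ (L : E4 ≃L[ℝ] E4).apply_symm_apply c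
  -- splitting of the directions
  have hdir : ∀ (B G : E4 →L[ℝ] E4) (c : E4),
      (((0 : ℝ), (B + G).comp (S t), c) : ℝ × (E4 →L[ℝ] E4) × E4) =
        ((0 : ℝ), B.comp (S t), (L : E4 ≃L[ℝ] E4) (S t c)) + ((0 : ℝ), G.comp (S t), (0 : E4)) := by
    intro B G c
    rw [hLS, Prod.mk_add_mk, Prod.mk_add_mk, add_zero, add_zero, ContinuousLinearMap.add_comp]
  have hvar : ∀ (B : E4 →L[ℝ] E4), (∀ v w, Minkowski.bilin (B v) w + Minkowski.bilin v (B w) = 0) →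
      ∀ c : E4, M • Dom ((0 : ℝ), B.comp (S t), (L : E4 ≃L[ℝ] E4) (S t c)) =
        (fderiv ℝ (Kerr.bilin M a) (poincareInv L 0 z) (B (poincareInv L 0 z) + S t c)).bilinearComp (S t) (S t) +
        (Kerr.bilin M a (poincareInv L 0 z)).bilinearComp (B.comp (S t)) (S t) +
        (Kerr.bilin M a (poincareInv L 0 z)).bilinearComp (S t) (B.comp (S t)) := fun B hB c ↦
    higherOrder_smul_fderiv_omega_eq_var L hB (S t c) M a z hz
  refine ⟨?_, ?_, higherOrder_norm_smul_apply_midDir M Dom _ _ |>.trans ?_,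
    higherOrder_norm_smul_apply_midDir M Dom _ _ |>.trans ?_⟩
  · rw [hS2]
    change M • Dom ((0 : ℝ), (deriv A t + (A t).comp (A t)).comp (S t), c₂) = _
    rw [hdir, map_add, smul_add, hvar _ hskew']
  · rw [hS3]
    change M • Dom ((0 : ℝ), (iteratedDeriv 2 A t + (2 : ℝ) • (deriv A t).comp (A t) +
      (A t).comp (deriv A t) + ((A t).comp (A t)).comp (A t)).comp (S t), c₃) = _
    rw [show iteratedDeriv 2 A t + (2 : ℝ) • (deriv A t).comp (A t) + (A t).comp (deriv A t) +
        ((A t).comp (A t)).comp (A t) = iteratedDeriv 2 A t + G₃ by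
      simp only [G₃]; abel]
    rw [hdir, map_add, smul_add, hvar _ hskew'']
  · gcongr
    calc ‖(A t).comp (A t)‖ ≤ ‖A t‖ * ‖A t‖ := ContinuousLinearMap.opNorm_comp_le _ _
      _ = ‖A t‖ ^ 2 := by ring
  · gcongr
    calc ‖G₃‖ ≤ ‖(2 : ℝ) • (deriv A t).comp (A t)‖ + ‖(A t).comp (deriv A t)‖ +
          ‖((A t).comp (A t)).comp (A t)‖ := norm_add₃_le
      _ ≤ 2 * (‖deriv A t‖ * ‖A t‖) + ‖A t‖ * ‖deriv A t‖ + ‖A t‖ * ‖A t‖ * ‖A t‖ := by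
          gcongr
          · rw [norm_smul, Real.norm_eq_abs, abs_two]
            gcongr; exact ContinuousLinearMap.opNorm_comp_le _ _
          · exact ContinuousLinearMap.opNorm_comp_le _ _
          · exact (ContinuousLinearMap.opNorm_comp_le _ _).trans
              (mul_le_mul_of_nonneg_right (ContinuousLinearMap.opNorm_comp_le _ _) (norm_nonneg _))
      _ = 3 * ‖deriv A t‖ * ‖A t‖ + ‖A t‖ ^ 3 := by ring

/-- **Registered one-line carrier form** (`higherOrder_midDir_EF`) of
`higherOrder_norm_smul_apply_midDir`. [folklore] -/
theorem higherOrder_midDir_EF : ∀ (M : ℝ) (T : (ℝ × (E4 →L[ℝ] E4) × E4) →L[ℝ] (E4 →L[ℝ] E4 →L[ℝ] ℝ)) (G S : E4 →L[ℝ] E4), ‖M • T ((0 : ℝ), G.comp S, (0 : E4))‖ ≤ |M| * ‖T‖ * ‖G‖ * ‖S‖ :=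
  fun M T G S ↦ higherOrder_norm_smul_apply_midDir M T G S

end Summit.FinalStateConjecture.FinalStateConjecture.Theorems.SublinearIsFree.Slaving

end
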